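import Literature.NumberTheory.LFunctions.RealZeroEffectiveRepulsionExplicit
import Literature.NumberTheory.LFunctions.ExceptionalCharacterTwinPrimes
import HarnessLib

/-!
# Effective conductor floors for exceptional characters on the `L(1,χ)` side (PROVED only; debt 0)

Topic `Literature/NumberTheory/LFunctions`. Typed for the cell `parity-realchar` (SIEGEL INSTRUMENT,
deliverable (3) «illusory-world conditionals», §1 dictionary / shape rule S6 audit). The tree's
KERNEL floor `‖L(1,χ)‖ ≥ 0.69/√q` for every real primitive `χ` mod `q ≥ 3` (class number formula;
`RealZeroRepulsion.norm_LFunction_one_ge`, `RealZeroEffectiveRepulsionExplicit.lean`) gives, for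
free, EFFECTIVE lower bounds on the conductor of any witness of the column's `L(1)`-side hypotheses
— the `L(1)`-side companions of `RealZeroRepulsion.isSiegelZero_conductor_ge` (`q ≥ η/800` for a
Siegel zero of quality `η`):

* `strength_witness_floor` — a witness of strength `A` (`‖L(1,χ)‖ ≤ (log q)^{−A}`, the shape of
  `ExceptionalCharactersOfStrength A`, of Friedlander–Iwaniec's (9.3), of Bui–Pratt–Zaharescu's
  dichotomy threshold `(log D)^{−50}`) has `0.69 (log q)^A ≤ √q`;
* `smallEta_witness_floor` — a witness of `η(D) = ‖L(1,χ_D)‖ log D ≤ ε` (Friedlander–Iwaniec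
  2019, (1.6); Conrey–Iwaniec's «`ε`-exceptional») has `0.69 log D ≤ ε √D`;
* `not_strength_fifty_of_log_le` — the numerical instance **no primitive quadratic `χ` mod `q` with
  `3 ≤ q ≤ e^{600}` satisfies `‖L(1,χ)‖ ≤ (log q)^{−50}`** (piecewise comparison of `e^{x/2}` with
  `0.69 x^{50}` on `[log 3, 600]`), so Bui–Pratt–Zaharescu's second branch
  («`L(1,ψ) < (log D)^{−50}` ⇒ analytic ranks of `J₀(q)` concentrate», tree
  `buiPrattZaharescu2024_theorem11`, topic I.9) — and every hypothesis of strength `A ≥ 50` — can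
  only be triggered by conductors `D > e^{600} ≈ 10^{260}`: a KERNEL range, no table, no named fact
  (compare the Siegel-INEFFECTIVE vacuity of shape rule S6 and the Watkins range
  `Watkins2021.not_isExceptional`, `3 ≤ D ≤ e^{625}`);
* `exceptionalCharactersOfStrength_witness_gt` — packaged on the column's predicate: every witness of
  `ExceptionalCharactersOfStrength 50` has conductor `> e^{600}`.

LABEL (cell rule): instrument / kernel comparator (effective, weak constants). WHAT THIS IS NOT: no
claim about the existence of exceptional characters; the floors are far below the truth
(`L(1,χ) ≫_ε q^{−ε}`, Siegel, ineffective); nothing here bears on the parity summit.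

## References

* [MontgomeryVaughan2007] H. L. Montgomery, R. C. Vaughan, *Multiplicative Number Theory I*, §4.3
  (class number formula) — the source of the kernel floor.
* [FriedlanderIwaniec2019TwinPrimes] (1.6) (`η(D)`); [BuiPrattZaharescu2024] Theorem 1.1 (the
  threshold `(log D)^{−50}`).
-/

noncomputable section

open Real

namespace Literature.NumberTheory.LFunctions

/-! ### The two floors -/

/-- **Strength-`A` witnesses have `0.69 (log q)^A ≤ √q`**: from the kernel floor
`‖L(1,χ)‖ ≥ 0.69/√q` and `‖L(1,χ)‖ ≤ (log q)^{−A}`. [cite: MontgomeryVaughan2007, §4.3 (class number formula)] -/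
theorem strength_witness_floor {q : ℕ} [NeZero q] (hq : 3 ≤ q) {χ : DirichletCharacter ℂ q}
    (hprim : χ.IsPrimitive) (hquad : χ.IsQuadratic) {A : ℝ}
    (hA : ‖χ.LFunction 1‖ ≤ Real.log q ^ (-A)) :
    (69 / 100) * Real.log q ^ A ≤ Real.sqrt q := by
  have hfloor := RealZeroRepulsion.norm_LFunction_one_ge hq hprim hquad
  have hq3 : (3 : ℝ) ≤ q := by exact_mod_cast hq
  have hlog : 0 < Real.log q := Real.log_pos (by linarith)
  have hsq : 0 < Real.sqrt q := Real.sqrt_pos.mpr (by linarith)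
  have hpowA : 0 < Real.log q ^ A := Real.rpow_pos_of_pos hlog A
  -- `0.69/√q ≤ (log q)^{-A} = ((log q)^A)⁻¹`
  have h1 : (69 / 100) / Real.sqrt q ≤ (Real.log q ^ A)⁻¹ := by
    have := hfloor.trans hA
    rwa [Real.rpow_neg hlog.le] at this
  rw [div_le_iff₀ hsq] at h1
  -- `0.69 ≤ ((log q)^A)⁻¹ √q`, multiply by `(log q)^A`
  have h2 : (69 / 100) * Real.log q ^ A ≤ (Real.log q ^ A)⁻¹ * Real.sqrt q * Real.log q ^ A :=
    mul_le_mul_of_nonneg_right h1 hpowA.le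
  calc (69 / 100) * Real.log q ^ A ≤ (Real.log q ^ A)⁻¹ * Real.sqrt q * Real.log q ^ A := h2
    _ = Real.sqrt q := by field_simp

/-- **Small-`η(D)` witnesses have `0.69 log D ≤ ε √D`**: from the kernel floor and
`‖L(1,χ)‖ log D ≤ ε`. [cite: MontgomeryVaughan2007, §4.3 (class number formula)]
[cite: FriedlanderIwaniec2019TwinPrimes, (1.6)] -/
theorem smallEta_witness_floor {D : ℕ} [NeZero D] (hD : 3 ≤ D) {χ : DirichletCharacter ℂ D}
    (hprim : χ.IsPrimitive) (hquad : χ.IsQuadratic) {ε : ℝ}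
    (hε : ‖χ.LFunction 1‖ * Real.log D ≤ ε) :
    (69 / 100) * Real.log D ≤ ε * Real.sqrt D := by
  have hfloor := RealZeroRepulsion.norm_LFunction_one_ge hD hprim hquad
  have hD3 : (3 : ℝ) ≤ D := by exact_mod_cast hD
  have hlog : 0 < Real.log D := Real.log_pos (by linarith)
  have hsq : 0 < Real.sqrt D := Real.sqrt_pos.mpr (by linarith)
  have h1 : (69 / 100) / Real.sqrt D * Real.log D ≤ ε :=
    (mul_le_mul_of_nonneg_right hfloor hlog.le).trans hε
  rw [div_mul_eq_mul_div, div_le_iff₀ hsq] at h1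
  exact h1

/-! ### The numerical instance `A = 50`: conductors `≤ e^{600}` are excluded -/

/-- `log 3 ≥ 1.0529` (from `log 3 = 2 log 2 − log(4/3)`, `log 2 > 0.6931471803` and
`log(4/3) ≤ 4/3 − 1`). [folklore] -/
private theorem log_three_ge : (1.0529 : ℝ) ≤ Real.log 3 := by
  have h2 : (0.6931471803 : ℝ) < Real.log 2 := Real.log_two_gt_d9
  have h43 : Real.log (4 / 3) ≤ 4 / 3 - 1 := Real.log_le_sub_one_of_pos (by norm_num)
  have heq : Real.log 3 = 2 * Real.log 2 - Real.log (4 / 3) := by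
    have : Real.log (4 / 3) = Real.log 4 - Real.log 3 := by
      rw [Real.log_div (by norm_num) (by norm_num)]
    have h4 : Real.log 4 = 2 * Real.log 2 := by
      rw [show (4 : ℝ) = 2 ^ 2 by norm_num, Real.log_pow]; norm_num
    linarith
  linarith

/-- The piecewise comparison: for `1.0529 ≤ x ≤ 600`, `e^{x/2} < 0.69 · x^{50}`. [folklore] -/
private theorem exp_half_lt_of_le {x : ℝ} (hlo : (1.0529 : ℝ) ≤ x) (hhi : x ≤ 600) :
    Real.exp (x / 2) < (69 / 100) * x ^ (50 : ℕ) := by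
  have he : Real.exp 1 < 2.72 := by have := Real.exp_one_lt_d9; linarith
  have he0 : 0 < Real.exp 1 := Real.exp_pos 1
  -- generic step: on `[a, 2n]`, `e^{x/2} ≤ e^n = (e)^n < 2.72^n` and `a^50 ≤ x^50`
  have step : ∀ (a : ℝ) (n : ℕ), 0 ≤ a → a ≤ x → x ≤ 2 * n →
      (2.72 : ℝ) ^ n ≤ (69 / 100) * a ^ (50 : ℕ) → Real.exp (x / 2) < (69 / 100) * x ^ (50 : ℕ) := by
    intro a n ha hax hxn hnum
    have h1 : Real.exp (x / 2) ≤ Real.exp n := Real.exp_le_exp.mpr (by linarith)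
    have h2 : Real.exp (n : ℝ) = Real.exp 1 ^ n := (Real.exp_one_pow n).symm
    have h3 : Real.exp 1 ^ n ≤ (2.72 : ℝ) ^ n := pow_le_pow_left₀ he0.le he.le n
    have h4 : a ^ (50 : ℕ) ≤ x ^ (50 : ℕ) := pow_le_pow_left₀ ha hax 50
    have h5 : (69 / 100) * a ^ (50 : ℕ) ≤ (69 / 100) * x ^ (50 : ℕ) :=
      mul_le_mul_of_nonneg_left h4 (by norm_num)
    -- strictness: `e^n < 2.72^n` for `n ≥ 1`; for `n = 0` the chain is still fine via `h1`… we
    -- assemble with one strict link `exp 1 ^ n ≤ 2.72^n` made strict when `n ≥ 1`, else use `hnum`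
    rcases Nat.eq_zero_or_pos n with hn | hn
    · subst hn
      -- `x ≤ 0` contradicts `x ≥ 1.0529`
      push_cast at hxn
      linarith
    · have h3' : Real.exp 1 ^ n < (2.72 : ℝ) ^ n := pow_lt_pow_left₀ he he0.le hn.ne'
      calc Real.exp (x / 2) ≤ Real.exp n := h1
        _ = Real.exp 1 ^ n := h2
        _ < (2.72 : ℝ) ^ n := h3'
        _ ≤ (69 / 100) * a ^ (50 : ℕ) := hnum
        _ ≤ (69 / 100) * x ^ (50 : ℕ) := h5
  -- variant for the last piece: group `e^{3k} = (e^3)^k < 20.1^k` (smaller numerals for `norm_num`)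
  have step3 : ∀ (a : ℝ) (k : ℕ), 0 ≤ a → a ≤ x → x ≤ 6 * k → 0 < k →
      (20.1 : ℝ) ^ k ≤ (69 / 100) * a ^ (50 : ℕ) → Real.exp (x / 2) < (69 / 100) * x ^ (50 : ℕ) := by
    intro a k ha hax hxk hk hnum
    have he3 : Real.exp 1 ^ 3 < 20.1 := by
      have h := Real.exp_one_lt_d9
      have h0 : 0 < Real.exp 1 := Real.exp_pos 1
      have : Real.exp 1 ^ 3 < (2.7182818286 : ℝ) ^ 3 := pow_lt_pow_left₀ h h0.le (by norm_num)
      linarith [show ((2.7182818286 : ℝ)) ^ 3 < 20.1 by norm_num]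
    have h1 : Real.exp (x / 2) ≤ Real.exp ((3 * k : ℕ) : ℝ) := Real.exp_le_exp.mpr (by push_cast; linarith)
    have h2 : Real.exp (((3 * k : ℕ) : ℝ)) = (Real.exp 1 ^ 3) ^ k := by
      rw [← Real.exp_one_pow, pow_mul]
    have h3 : (Real.exp 1 ^ 3) ^ k < (20.1 : ℝ) ^ k :=
      pow_lt_pow_left₀ he3 (pow_nonneg (Real.exp_pos 1).le 3) hk.ne'
    have h4 : a ^ (50 : ℕ) ≤ x ^ (50 : ℕ) := pow_le_pow_left₀ ha hax 50
    have h5 : (69 / 100) * a ^ (50 : ℕ) ≤ (69 / 100) * x ^ (50 : ℕ) :=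
      mul_le_mul_of_nonneg_left h4 (by norm_num)
    calc Real.exp (x / 2) ≤ Real.exp ((3 * k : ℕ) : ℝ) := h1
      _ = (Real.exp 1 ^ 3) ^ k := h2
      _ < (20.1 : ℝ) ^ k := h3
      _ ≤ (69 / 100) * a ^ (50 : ℕ) := hnum
      _ ≤ (69 / 100) * x ^ (50 : ℕ) := h5
  rcases le_or_gt x 2 with hx2 | hx2
  · exact step 1.0529 1 (by norm_num) hlo (by push_cast; linarith) (by norm_num)
  rcases le_or_gt x 10 with hx10 | hx10
  · exact step 2 5 (by norm_num) hx2.le (by push_cast; linarith) (by norm_num)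
  rcases le_or_gt x 50 with hx50 | hx50
  · exact step 10 25 (by norm_num) hx10.le (by push_cast; linarith) (by norm_num)
  rcases le_or_gt x 100 with hx100 | hx100
  · exact step 50 50 (by norm_num) hx50.le (by push_cast; linarith) (by norm_num)
  rcases le_or_gt x 200 with hx200 | hx200
  · exact step 100 100 (by norm_num) hx100.le (by push_cast; linarith) (by norm_num)
  rcases le_or_gt x 400 with hx400 | hx400
  · exact step 200 200 (by norm_num) hx200.le (by push_cast; linarith) (by norm_num)
  rcases le_or_gt x 500 with hx500 | hx500
  · exact step 400 250 (by norm_num) hx400.le (by push_cast; linarith) (by norm_num)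
  · exact step3 500 100 (by norm_num) hx500.le (by push_cast; linarith) (by norm_num) (by norm_num)

/-- **KERNEL: no primitive quadratic `χ` mod `q` with `3 ≤ q ≤ e^{600}` has
`‖L(1,χ)‖ ≤ (log q)^{−50}`.** (The floor gives `0.69 (log q)^{50} ≤ √q = e^{(log q)/2}`, contradicting
`e^{x/2} < 0.69 x^{50}` on `[log 3, 600]`.) So every hypothesis of strength `≥ 50` — in particular the
second branch of Bui–Pratt–Zaharescu's Theorem 1.1 (`L(1,ψ) < (log D)^{−50}`) — needs a conductor
`> e^{600}`. [cite: MontgomeryVaughan2007, §4.3 (class number formula)] -/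
theorem not_strength_fifty_of_log_le {q : ℕ} [NeZero q] (hq : 3 ≤ q)
    (hqe : Real.log q ≤ 600) {χ : DirichletCharacter ℂ q} (hprim : χ.IsPrimitive)
    (hquad : χ.IsQuadratic) : ¬ ‖χ.LFunction 1‖ ≤ Real.log q ^ (-(50 : ℝ)) := by
  intro hA
  have hfl := strength_witness_floor hq hprim hquad hA
  have hq3 : (3 : ℝ) ≤ q := by exact_mod_cast hq
  have hq0 : (0 : ℝ) < q := by linarith
  -- `√q = e^{(log q)/2}`
  have hsqrt : Real.sqrt q = Real.exp (Real.log q / 2) := by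
    rw [Real.sqrt_eq_rpow, Real.rpow_def_of_pos hq0]
    congr 1; ring
  have hlo : (1.0529 : ℝ) ≤ Real.log q :=
    log_three_ge.trans (Real.log_le_log (by norm_num) hq3)
  have hlt := exp_half_lt_of_le hlo hqe
  rw [show (50 : ℝ) = ((50 : ℕ) : ℝ) by norm_num, Real.rpow_natCast, hsqrt] at hfl
  linarith

/-- The same with the conductor bound stated as `q ≤ e^{600}` (a real bound on the modulus).
[cite: MontgomeryVaughan2007, §4.3 (class number formula)] -/
theorem not_strength_fifty_of_le_exp {q : ℕ} [NeZero q] (hq : 3 ≤ q)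
    (hqe : (q : ℝ) ≤ Real.exp 600) {χ : DirichletCharacter ℂ q} (hprim : χ.IsPrimitive)
    (hquad : χ.IsQuadratic) : ¬ ‖χ.LFunction 1‖ ≤ Real.log q ^ (-(50 : ℝ)) := by
  have hq0 : (0 : ℝ) < q := by exact_mod_cast (show 0 < q by omega)
  have hlog : Real.log q ≤ 600 := by
    calc Real.log q ≤ Real.log (Real.exp 600) := Real.log_le_log hq0 hqe
      _ = 600 := Real.log_exp 600
  exact not_strength_fifty_of_log_le hq hlog hprim hquad

/-- **On the column's predicate**: every witness of `ExceptionalCharactersOfStrength 50` (hence of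
any strength `A ≥ 50`, `ExceptionalCharactersOfStrength.anti`) has conductor `> e^{600}` — a kernel
(effective, table-free) range in which the strength-`50` illusory world is void.
[cite: MontgomeryVaughan2007, §4.3 (class number formula)] [cite: Merikoski2024ExceptionalCharacters, §1 (the exponent "such as 100")] -/
theorem exceptionalCharactersOfStrength_witness_gt {q : ℕ} [NeZero q] {χ : DirichletCharacter ℂ q}
    (hprim : χ.IsPrimitive) (hne : χ ≠ 1) (hquad : χ.IsQuadratic)
    (hA : ‖χ.LFunction 1‖ ≤ Real.log q ^ (-(50 : ℝ))) : Real.exp 600 < q := by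
  by_contra hle
  rw [not_lt] at hle
  -- a primitive non-trivial character has modulus `≥ 3`
  have hq3 : 3 ≤ q := by
    by_contra hlt
    rw [not_le] at hlt
    have h1 : 1 ≤ q := Nat.pos_of_ne_zero (NeZero.ne q)
    interval_cases q
    · exact hne (DirichletCharacter.level_one χ)
    · have hsub : Subsingleton (ZMod 2)ˣ := by
        refine Fintype.card_le_one_iff_subsingleton.mp ?_
        rw [ZMod.card_units_eq_totient, Nat.totient_two]
      exact hne (MulChar.ext fun a => by rw [Subsingleton.elim a 1, Units.val_one, map_one, map_one])
  exact not_strength_fifty_of_le_exp hq3 hle hprim hquad hA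

end Literature.NumberTheory.LFunctions

end
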